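import Summits.Schanuel.Schanuel.Theorems.RootDecomp1KHyper71

/-!
# RootDecomp1KHyper — lens 6, generation 17 «BILOG STAIRCASE CELL» (BilogStair.lean edition 7 637b15ab…, 5821 l; §R TransferI ⟸ ElimDataI) — continuation (RootDecomp1KHyper72): §R (i) `fI`, `gI`, the typed elimination datum `ElimDataI` (UNDECIDED), evaluation lemmas, `evB_of_bezout`, `lenB`, `toFin1`, the integer specialisation `specQ` and its bounds, `exists_transfer_of_ne_zero`

(lens-6 g17 `BilogStair.lean` EDITION 7, sha256 637b15ab…d5b9, 5821 l, own farm rc 0 · 0 warn · 0 sorry · axioms std; §A–§P = editions 2–6 (ported as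
`RootDecomp1KHyper53`–`71`), §R appended in edition 7 (NODE/EDITION7 L1820 / REQUEST L1821: statement diff 0 removed / 0 changed / 32 added; critic VERDICT L1827: CLEARED as EDITION 7 of record, `ElimDataI` NOT a costume and TRUE as typed, TransferI credit DEFERRED to its proof; PORT GO (three parts here because of the 398-line cap));
port by census-1 gen 16 in parts `RootDecomp1KHyper72`–`74` — 72 = §R the elimination datum `ElimDataI` (Prop def, UNDECIDED: a Bezout identity between the FIXED
`fI G₁ = G₁(x₁, X, u x₁ + v X)` and `gI P₂` over `B4 = ℤ[x₁, T, u, v]`), `fI_map_eval` / `gI_map_eval`, `evB_of_bezout`, `lenB`, killing the dummy variable (`toFin1`), the integer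
specialisation `specQ` with length/degree bounds, the conjugate transfer for a fixed `R ≠ 0` (`exists_transfer_of_ne_zero`); 73 = the generic π-clash `pi_clash_fin1` and the FAMILY
NORM CLASH `resT_family_clash`; 74 = `norm_aeval_third_le`, `transferI_of_elimData : ElimDataI → TransferI` (PROVED reduction) and `sb_three_zB_of_elimData : ElimDataI → SB 3 zB`.
PORT edits: `sum_fin4` / `one_le_plen` / `cast_div_eq` private (per-part copies); eleven one-line docstrings added; the source's two `set_option linter.unusedSimpArgs false in` lines
(on `fI_map_eval` / `gI_map_eval`) carried as-is; statements and proofs otherwise verbatim. No credit carried (the THEOREM-credit claim «TransferI ⟸ ElimDataI» is the critic's to rule);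
`--supports stmt-Schanuel-33363`; rung 0.)
-/

open Complex Polynomial IntermediateField Filter
open scoped BigOperators

namespace Summit.Schanuel.Schanuel.Theorems.RootDecomp1KHyper

namespace HyperCell

namespace LatCell

namespace Bilog

variable {n : ℕ}
open Summit.Schanuel.Schanuel.Theorems.RootDecomp1KRelLiouvilleCell (mvPolyMeasure_one_of_polyMeasure ycoeff
  mvaeval_cons_eq_sum mvlen_ycoeff_le natDegree_finSuccEquiv_le_totalDegree norm_mvaeval_le_mvlen_mul_pow)

open Summit.Schanuel.Schanuel.Theorems.RootDecomp1KGeneric (norm_mvAeval_sub_le norm_cexp_sub_cexp_le lenMv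
  lenMv_nonneg)

section CaseI

/-! ## §R  (EDITION 7) TRANSFER I ⟸ ONE PURELY ALGEBRAIC STATEMENT ABOUT FIXED POLYNOMIALS (`ElimDataI`)

RE-ASSESSMENT of Case I.  Case I (`π, ℓ` algebraically independent) does NOT need a measure of algebraic
independence of `(π, log α)`: it has TWO approximate relations `G₁(π, ℓ, a_kπ + b_kℓ) ≈ 0`, `P₂(π, ℓ, γ_k) ≈ 0`
sharing the coordinate `ℓ`; eliminating `x₂ = ℓ` between the FIXED polynomials `G₁(x₁, X, u x₁ + v X)` and
`P₂(x₁, X, T)` over `ℤ[x₁, T, u, v]` (a Bezout identity `f·p + g·q = C R`, Mathlib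
`Polynomial.exists_mul_add_mul_eq_C_resultant`) leaves `R(π, γ_k, a_k, b_k)` hyper-small with `R` FIXED; the norm
`Res_T(f_k, E_k^D R(x₁, T, a_k, b_k))` (conjugate data `ConjDataII`, PROVED) is an integer polynomial in `π` ALONE,
and the tree-PROVED Nesterenko–Waldschmidt measure of `π` forces a conjugate slice `R(x₁, γ', a_k, b_k) ≡ 0`,
whence (conjugate transfer, `π ∉ ℚ̄`) the fixed relation `F(γ_k, a_k, b_k) = 0`.  The ONLY piece left is the
algebra of fixed polynomials `ElimDataI` (existence of the Bezout datum with `R ≠ 0`; blueprint: replace `G₂` by an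
irreducible relation `P₂`, then `R = Res_X ≠ 0` by Gauss's lemma and a degree-in-`T` count).
THEOREMS: `transferI_of_elimData : ElimDataI → TransferI`, `sb_three_zB_of_elimData : ElimDataI → SB 3 zB`. -/

/-- `G(x₁, X, u x₁ + v X)` as a polynomial in `X = x₂` over `B4 = ℤ[x₁, T, u, v]`. -/
noncomputable def fI (G : MvPolynomial (Fin 3) ℤ) : Polynomial B4 :=
  MvPolynomial.aeval (![Polynomial.C (MvPolynomial.X 0), Polynomial.X,
    Polynomial.C (MvPolynomial.X 2) * Polynomial.C (MvPolynomial.X 0) +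
      Polynomial.C (MvPolynomial.X 3) * Polynomial.X] : Fin 3 → Polynomial B4) G

/-- `G(x₁, X, T)` as a polynomial in `X = x₂` over `B4 = ℤ[x₁, T, u, v]`. -/
noncomputable def gI (G : MvPolynomial (Fin 3) ℤ) : Polynomial B4 :=
  MvPolynomial.aeval (![Polynomial.C (MvPolynomial.X 0), Polynomial.X,
    Polynomial.C (MvPolynomial.X 1)] : Fin 3 → Polynomial B4) G

/-- **ELIMINATION DATUM** (piece, typed — UNDECIDED; pure algebra of FIXED polynomials).  Given integer relations
`G₁ ≠ 0` (of `(u, v, y)`, not needed here) and `G₂(u, v, w) = 0` with `(u, v)` algebraically independent, there is a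
relation `P₂(u, v, w) = 0` and a Bezout identity `G₁(x₁, X, u' x₁ + v' X)·p + P₂(x₁, X, T)·q = C R` in
`ℤ[x₁, T, u', v'][X]` with `R ≠ 0`.  Blueprint: `P₂` an irreducible primitive factor of `G₂` vanishing at the point
(it involves `x₃` by the independence of `(u, v)`); `R := Res_X(fI G₁, gI P₂)` and `p, q` from
`Polynomial.exists_mul_add_mul_eq_C_resultant`; `R ≠ 0` since a common factor of positive `X`-degree would make the
irreducible `gI P₂` (positive `T`-degree) divide the `T`-free `fI G₁ ≠ 0` (Gauss's lemma over the UFD `B4`). -/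
def ElimDataI : Prop :=
  ∀ G₁ G₂ : MvPolynomial (Fin 3) ℤ, G₁ ≠ 0 → G₂ ≠ 0 → ∀ u v w : ℂ, AlgebraicIndependent ℚ ![u, v] →
    MvPolynomial.aeval ![u, v, w] G₂ = 0 →
    ∃ (P₂ : MvPolynomial (Fin 3) ℤ) (p q : Polynomial B4) (R : B4),
      MvPolynomial.aeval ![u, v, w] P₂ = 0 ∧ R ≠ 0 ∧ fI G₁ * p + gI P₂ * q = Polynomial.C R

set_option linter.unusedSimpArgs false in
/-- Evaluation of `fI G` : `(x₁, T, u, v, X) ↦ (t, θ, s, w, x)` gives `G(t, x, s t + w x)`. -/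
theorem fI_map_eval (G : MvPolynomial (Fin 3) ℤ) (t θ s w x : ℂ) :
    ((fI G).map (evB t θ s w)).eval x = MvPolynomial.aeval ![t, x, s * t + w * x] G := by
  unfold fI
  obtain ⟨χ, hχ⟩ : ∃ χ : Polynomial B4 →+* ℂ,
      χ = (Polynomial.evalRingHom x).comp (Polynomial.mapRingHom (evB t θ s w)) := ⟨_, rfl⟩
  have h := DFunLike.congr_fun (MvPolynomial.comp_aeval (R := ℤ) χ.toIntAlgHom
    (f := (![Polynomial.C (MvPolynomial.X 0), Polynomial.X,
      Polynomial.C (MvPolynomial.X 2) * Polynomial.C (MvPolynomial.X 0) +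
        Polynomial.C (MvPolynomial.X 3) * Polynomial.X] : Fin 3 → Polynomial B4))) G
  have hfun : (fun i => χ.toIntAlgHom ((![Polynomial.C (MvPolynomial.X 0), Polynomial.X,
      Polynomial.C (MvPolynomial.X 2) * Polynomial.C (MvPolynomial.X 0) +
        Polynomial.C (MvPolynomial.X 3) * Polynomial.X] : Fin 3 → Polynomial B4) i)) =
      ![t, x, s * t + w * x] := by
    funext i
    match i with
    | 0 => simp [hχ, evB_X]
    | 1 => simp [hχ, evB_X]
    | 2 => simp [hχ, evB_X]
  rw [hfun] at h
  refine Eq.trans ?_ h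
  rw [hχ]
  rfl

set_option linter.unusedSimpArgs false in
/-- Evaluation of `gI G` : `(x₁, T, u, v, X) ↦ (t, θ, s, w, x)` gives `G(t, x, θ)`. -/
theorem gI_map_eval (G : MvPolynomial (Fin 3) ℤ) (t θ s w x : ℂ) :
    ((gI G).map (evB t θ s w)).eval x = MvPolynomial.aeval ![t, x, θ] G := by
  unfold gI
  obtain ⟨χ, hχ⟩ : ∃ χ : Polynomial B4 →+* ℂ,
      χ = (Polynomial.evalRingHom x).comp (Polynomial.mapRingHom (evB t θ s w)) := ⟨_, rfl⟩
  have h := DFunLike.congr_fun (MvPolynomial.comp_aeval (R := ℤ) χ.toIntAlgHom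
    (f := (![Polynomial.C (MvPolynomial.X 0), Polynomial.X, Polynomial.C (MvPolynomial.X 1)] :
      Fin 3 → Polynomial B4))) G
  have hfun : (fun i => χ.toIntAlgHom ((![Polynomial.C (MvPolynomial.X 0), Polynomial.X,
      Polynomial.C (MvPolynomial.X 1)] : Fin 3 → Polynomial B4) i)) = ![t, x, θ] := by
    funext i
    match i with
    | 0 => simp [hχ, evB_X]
    | 1 => simp [hχ, evB_X]
    | 2 => simp [hχ, evB_X]
  rw [hfun] at h
  refine Eq.trans ?_ h
  rw [hχ]
  rfl

/-- Evaluation of a Bezout identity `f·p + g·q = C R` in `B4[X]`. -/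
theorem evB_of_bezout {f g p q : Polynomial B4} {R : B4} (h : f * p + g * q = Polynomial.C R)
    (t θ s w x : ℂ) :
    evB t θ s w R = (f.map (evB t θ s w)).eval x * (p.map (evB t θ s w)).eval x +
      (g.map (evB t θ s w)).eval x * (q.map (evB t θ s w)).eval x := by
  have h1 := congrArg (fun P : Polynomial B4 => (P.map (evB t θ s w)).eval x) h
  simp only [Polynomial.map_add, Polynomial.map_mul, Polynomial.eval_add, Polynomial.eval_mul,
    Polynomial.map_C, Polynomial.eval_C] at h1
  exact h1.symm

/-- Size of a polynomial over `B4`: total length and a crude total degree. -/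
noncomputable def lenB (p : Polynomial B4) : ℤ := ∑ i ∈ Finset.range (p.natDegree + 1), mvlen (p.coeff i)

/-- Definition unfolding of `degB`. -/
noncomputable def degB (p : Polynomial B4) : ℕ := p.natDegree + ∑ i ∈ Finset.range (p.natDegree + 1), (p.coeff i).totalDegree

/-- `lenB ≥ 0`. -/
theorem lenB_nonneg (p : Polynomial B4) : 0 ≤ lenB p := Finset.sum_nonneg fun _ _ => mvlen_nonneg _

/-- `‖p(t, θ, s, w; x)‖ ≤ lenB p · M^{degB p}` on the polydisc of radius `M ≥ 1`. -/
theorem norm_eval_map_evB_le (p : Polynomial B4) {t θ s w x : ℂ} {M : ℝ} (hM : 1 ≤ M)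
    (ht : ‖t‖ ≤ M) (hθ : ‖θ‖ ≤ M) (hs : ‖s‖ ≤ M) (hw : ‖w‖ ≤ M) (hx : ‖x‖ ≤ M) :
    ‖(p.map (evB t θ s w)).eval x‖ ≤ ((lenB p : ℤ) : ℝ) * M ^ degB p := by
  classical
  rw [Polynomial.eval_map, Polynomial.eval₂_eq_sum_range]
  refine (norm_sum_le _ _).trans ?_
  unfold lenB degB
  push_cast
  rw [Finset.sum_mul]
  refine Finset.sum_le_sum fun i hi => ?_
  rw [norm_mul, norm_pow]
  have hcoef : ‖evB t θ s w (p.coeff i)‖ ≤ ((mvlen (p.coeff i) : ℤ) : ℝ) * M ^ (p.coeff i).totalDegree := by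
    have := norm_mvaeval_le_mvlen_mul_pow (p.coeff i) (![t, θ, s, w] : Fin 4 → ℂ) hM (fun j => by
      match j with
      | 0 => exact ht
      | 1 => exact hθ
      | 2 => exact hs
      | 3 => exact hw) le_rfl
    exact this
  have hml0 : (0 : ℝ) ≤ ((mvlen (p.coeff i) : ℤ) : ℝ) := by exact_mod_cast mvlen_nonneg _
  have hdi : (p.coeff i).totalDegree + i ≤
      p.natDegree + ∑ j ∈ Finset.range (p.natDegree + 1), (p.coeff j).totalDegree := by
    have h1 : (p.coeff i).totalDegree ≤ ∑ j ∈ Finset.range (p.natDegree + 1), (p.coeff j).totalDegree :=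
      Finset.single_le_sum (f := fun j => (p.coeff j).totalDegree) (fun _ _ => Nat.zero_le _) hi
    have h2 : i ≤ p.natDegree := Nat.lt_succ_iff.mp (Finset.mem_range.mp hi)
    omega
  calc ‖evB t θ s w (p.coeff i)‖ * ‖x‖ ^ i
      ≤ (((mvlen (p.coeff i) : ℤ) : ℝ) * M ^ (p.coeff i).totalDegree) * M ^ i :=
        mul_le_mul hcoef (pow_le_pow_left₀ (norm_nonneg _) hx i) (by positivity) (by positivity)
    _ = ((mvlen (p.coeff i) : ℤ) : ℝ) * M ^ ((p.coeff i).totalDegree + i) := by rw [pow_add]; ring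
    _ ≤ ((mvlen (p.coeff i) : ℤ) : ℝ) *
        M ^ (p.natDegree + ∑ j ∈ Finset.range (p.natDegree + 1), (p.coeff j).totalDegree) :=
        mul_le_mul_of_nonneg_left (pow_le_pow_right₀ hM hdi) hml0

/-! ### Killing the dummy variable `x₂`: `ℤ[x₁, x₂] → ℤ[x₁]`, `x₂ ↦ 0` -/

/-- `N(x₁, 0)` as a one-variable polynomial. -/
noncomputable def toFin1 (N : MvPolynomial (Fin 2) ℤ) : MvPolynomial (Fin 1) ℤ :=
  MvPolynomial.aeval (![MvPolynomial.X 0, 0] : Fin 2 → MvPolynomial (Fin 1) ℤ) N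

/-- Evaluating `toFin1 P` at `x` is evaluating `P` at `(x, 0)`. -/
theorem aeval_toFin1 (N : MvPolynomial (Fin 2) ℤ) (x : ℂ) :
    MvPolynomial.aeval ![x] (toFin1 N) = MvPolynomial.aeval ![x, 0] N := by
  unfold toFin1
  have h := DFunLike.congr_fun (MvPolynomial.comp_aeval (R := ℤ)
    (MvPolynomial.aeval (![x] : Fin 1 → ℂ) : MvPolynomial (Fin 1) ℤ →ₐ[ℤ] ℂ)
    (f := (![MvPolynomial.X 0, 0] : Fin 2 → MvPolynomial (Fin 1) ℤ))) N
  have hfun : (fun i => (MvPolynomial.aeval (![x] : Fin 1 → ℂ) : MvPolynomial (Fin 1) ℤ →ₐ[ℤ] ℂ)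
      ((![MvPolynomial.X 0, 0] : Fin 2 → MvPolynomial (Fin 1) ℤ) i)) = ![x, 0] := by
    funext i
    match i with
    | 0 => simp
    | 1 => simp
  rw [hfun] at h
  exact h

/-- `toFin1` on monomials. -/
theorem toFin1_monomial (s : Fin 2 →₀ ℕ) (c : ℤ) :
    toFin1 (MvPolynomial.monomial s c) =
      if s 1 = 0 then MvPolynomial.monomial (Finsupp.single 0 (s 0)) c else 0 := by
  unfold toFin1
  rw [MvPolynomial.aeval_monomial, Finsupp.prod_pow, Fin.prod_univ_two]
  simp only [Matrix.cons_val_zero, Matrix.cons_val_one, eq_intCast]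
  split_ifs with h
  · rw [h, pow_zero, mul_one, MvPolynomial.monomial_eq,
      Finsupp.prod_single_index (h := fun n e => MvPolynomial.X n ^ e) (by simp)]
    simp
  · simp [zero_pow h]

/-- `mvlen (toFin1 P) ≤ mvlen P`. -/
theorem mvlen_toFin1_le (N : MvPolynomial (Fin 2) ℤ) : mvlen (toFin1 N) ≤ mvlen N := by
  classical
  conv_lhs => rw [MvPolynomial.as_sum N]
  unfold toFin1
  rw [map_sum]
  refine (mvlen_sum_le _ _).trans ?_
  have hper : ∀ s ∈ N.support,
      mvlen (MvPolynomial.aeval (![MvPolynomial.X 0, 0] : Fin 2 → MvPolynomial (Fin 1) ℤ)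
        (MvPolynomial.monomial s (MvPolynomial.coeff s N))) ≤ |MvPolynomial.coeff s N| := by
    intro s _
    have h := toFin1_monomial s (MvPolynomial.coeff s N)
    unfold toFin1 at h
    rw [h]
    split_ifs
    · rw [mvlen_monomial]
    · rw [mvlen_zero]; exact abs_nonneg _
  exact (Finset.sum_le_sum hper).trans (le_of_eq rfl)

/-- `tdeg (toFin1 P) ≤ tdeg P`. -/
theorem totalDegree_toFin1_le (N : MvPolynomial (Fin 2) ℤ) : (toFin1 N).totalDegree ≤ N.totalDegree := by
  classical
  conv_lhs => rw [MvPolynomial.as_sum N]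
  unfold toFin1
  rw [map_sum]
  refine (MvPolynomial.totalDegree_finsetSum _ _).trans (Finset.sup_le fun s hs => ?_)
  have h := toFin1_monomial s (MvPolynomial.coeff s N)
  unfold toFin1 at h
  rw [h]
  split_ifs
  · refine (MvPolynomial.totalDegree_monomial_le _ _).trans ?_
    rw [Finsupp.sum_single_index rfl]
    refine le_trans ?_ (MvPolynomial.le_totalDegree hs)
    show s 0 ≤ s.sum (fun _ e => e)
    by_cases h00 : s 0 = 0
    · rw [h00]; exact Nat.zero_le _
    · exact Finset.single_le_sum (f := fun i => s i) (fun _ _ => Nat.zero_le _)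
        (Finsupp.mem_support_iff.mpr h00)
  · rw [MvPolynomial.totalDegree_zero]; exact Nat.zero_le _

/-! ### The integer specialisation `Q = E^D · R(x₁, T, A/E, B/E) ∈ ℤ[x₁, (x₂), T]` of `R ∈ ℤ[x₁, T, u, v]` -/

/-- Exponent remap `x₁^{s₀} T^{s₁} ↦ x₁^{s₀} T^{s₁}` into `ℤ[x₁, x₂, T]` (the middle variable is a dummy). -/
noncomputable def remapI (s : Fin 4 →₀ ℕ) : Fin 3 →₀ ℕ := Finsupp.single 0 (s 0) + Finsupp.single 2 (s 1)

/-- `specQ R A B E := Σ_s coeff_s(R) · A^{s₂} B^{s₃} E^{D − s₂ − s₃} · x₁^{s₀} T^{s₁}` (`D = totalDegree R`). -/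
noncomputable def specQ (R : B4) (A B : ℤ) (E : ℕ) : MvPolynomial (Fin 3) ℤ :=
  ∑ s ∈ R.support, MvPolynomial.monomial (remapI s)
    (MvPolynomial.coeff s R * A ^ (s 2) * B ^ (s 3) * (E : ℤ) ^ (R.totalDegree - s 2 - s 3))

/-- A sum over `Fin 4` spelled out. -/
private theorem sum_fin4 (s : Fin 4 →₀ ℕ) : (s.sum fun _ e => e) = s 0 + s 1 + s 2 + s 3 := by
  rw [Finsupp.sum_fintype s _ (fun _ => rfl), Fin.sum_univ_four]

/-- The `u, v`-degrees of a monomial are bounded by the total degree. -/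
theorem s23_le_totalDegree {R : B4} {s : Fin 4 →₀ ℕ} (hs : s ∈ R.support) :
    s 2 + s 3 ≤ R.totalDegree := by
  have h := MvPolynomial.le_totalDegree hs
  rw [sum_fin4] at h
  omega

/-- Product over `Fin 4` of the remapped exponents. -/
theorem prod_remapI (s : Fin 4 →₀ ℕ) (v : Fin 3 → ℂ) :
    ((remapI s).prod fun i e => v i ^ e) = v 0 ^ (s 0) * v 2 ^ (s 1) := by
  unfold remapI
  rw [Finsupp.prod_add_index' (fun _ => pow_zero _) (fun _ _ _ => pow_add _ _ _)]
  simp only [Finsupp.prod_single_index, pow_zero]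

/-- Sum over `Fin 4` of the remapped exponents. -/
theorem sum_remapI (s : Fin 4 →₀ ℕ) : ((remapI s).sum fun _ e => e) = s 0 + s 1 := by
  unfold remapI
  rw [Finsupp.sum_add_index' (fun _ => rfl) (fun _ _ _ => rfl), Finsupp.sum_single_index rfl,
    Finsupp.sum_single_index rfl]

/-- The value of the specialisation: `specQ R A B E (x, y, z) = E^D · R(x, z, A/E, B/E)`. -/
theorem aeval_specQ (R : B4) (A B : ℤ) {E : ℕ} (hE : E ≠ 0) (x y z : ℂ) :
    MvPolynomial.aeval ![x, y, z] (specQ R A B E) =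
      ((E : ℂ)) ^ R.totalDegree * MvPolynomial.aeval ![x, z, (A : ℂ) / E, (B : ℂ) / E] R := by
  classical
  have hE' : (E : ℂ) ≠ 0 := by exact_mod_cast hE
  have hsD : ∀ s ∈ R.support, s 2 + s 3 ≤ R.totalDegree := fun s hs => s23_le_totalDegree hs
  unfold specQ
  obtain ⟨D, hD⟩ : ∃ D : ℕ, D = R.totalDegree := ⟨_, rfl⟩
  rw [← hD]
  rw [← hD] at hsD
  conv_rhs => rw [MvPolynomial.as_sum R]
  rw [map_sum, map_sum, Finset.mul_sum]
  refine Finset.sum_congr rfl fun s hs => ?_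
  have hsD' := hsD s hs
  rw [MvPolynomial.aeval_monomial, MvPolynomial.aeval_monomial, prod_remapI, Finsupp.prod_pow, Fin.prod_univ_four]
  simp only [Matrix.cons_val_zero, Matrix.cons_val_two, Matrix.tail_cons, Matrix.head_cons, Matrix.cons_val_one,
    Matrix.cons_val_three, algebraMap_int_eq, eq_intCast]
  push_cast
  rw [div_pow, div_pow]
  have hpow : ((E : ℂ)) ^ D = (E : ℂ) ^ (D - s 2 - s 3) * (E : ℂ) ^ (s 2) * (E : ℂ) ^ (s 3) := by
    rw [← pow_add, ← pow_add]; congr 1; omega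
  rw [hpow]
  field_simp

/-- Length of the specialisation. -/
theorem mvlen_specQ_le (R : B4) (A B : ℤ) (E : ℕ) {M : ℤ} (hA : |A| ≤ M) (hB : |B| ≤ M) (hEM : (E : ℤ) ≤ M) :
    mvlen (specQ R A B E) ≤ mvlen R * M ^ R.totalDegree := by
  classical
  have hM0 : 0 ≤ M := (abs_nonneg A).trans hA
  unfold specQ
  refine (mvlen_sum_le _ _).trans ?_
  change _ ≤ (∑ s ∈ R.support, |MvPolynomial.coeff s R|) * M ^ R.totalDegree
  rw [Finset.sum_mul]
  refine Finset.sum_le_sum fun s hs => ?_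
  rw [mvlen_monomial, abs_mul, abs_mul, abs_mul, abs_pow, abs_pow, abs_pow, Nat.abs_cast]
  have hsD := s23_le_totalDegree hs
  calc |MvPolynomial.coeff s R| * |A| ^ s 2 * |B| ^ s 3 * (E : ℤ) ^ (R.totalDegree - s 2 - s 3)
      ≤ |MvPolynomial.coeff s R| * M ^ s 2 * M ^ s 3 * M ^ (R.totalDegree - s 2 - s 3) := by
        gcongr
    _ = |MvPolynomial.coeff s R| * M ^ R.totalDegree := by
        rw [mul_assoc, mul_assoc, ← pow_add, ← pow_add]; congr 2; omega

/-- Degree of the specialisation. -/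
theorem totalDegree_specQ_le (R : B4) (A B : ℤ) (E : ℕ) : (specQ R A B E).totalDegree ≤ R.totalDegree := by
  classical
  unfold specQ
  refine (MvPolynomial.totalDegree_finsetSum _ _).trans (Finset.sup_le fun s hs => ?_)
  refine (MvPolynomial.totalDegree_monomial_le _ _).trans ?_
  show ((remapI s).sum fun _ e => e) ≤ _
  rw [sum_remapI]
  have h := MvPolynomial.le_totalDegree hs
  rw [sum_fin4] at h
  omega

/-! ### The conjugate transfer for a FIXED `R ≠ 0 ∈ ℤ[x₁, T, u, v]` (as in §M, `π ∉ ℚ̄` + `minpoly.dvd`) -/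

/-- For `R ≠ 0` there is a FIXED `F ≠ 0 ∈ ℤ[T, u, v]` (the top `x₁`-coefficient of `R`) with:
`R(π, γ', p, q) = 0` for a conjugate `γ'` of the algebraic `γ` forces `F(γ, p, q) = 0`. -/
theorem exists_transfer_of_ne_zero {R : B4} (hR : R ≠ 0) :
    ∃ F : MvPolynomial (Fin 3) ℤ, F ≠ 0 ∧
      ∀ (p q : ℚ) (γ γ' : ℂ), IsIntegral ℚ γ → IsConjRoot ℚ γ γ' →
        evB (Real.pi : ℂ) γ' p q R = 0 → MvPolynomial.aeval ![γ, (p : ℂ), (q : ℂ)] F = 0 := by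
  classical
  obtain ⟨K, hK⟩ : ∃ K : ℕ, K = (MvPolynomial.finSuccEquiv ℤ 3 R).natDegree := ⟨_, rfl⟩
  refine ⟨ycoeff R K, ?_, ?_⟩
  · have h1 : MvPolynomial.finSuccEquiv ℤ 3 R ≠ 0 := (EmbeddingLike.map_ne_zero_iff).mpr hR
    rw [hK]
    exact Polynomial.leadingCoeff_ne_zero.mpr h1
  · intro p q γ γ' hγ hconj hev
    have hγ' : IsIntegral ℚ γ' := ⟨minpoly ℚ γ, minpoly.monic hγ, hconj.aeval_eq_zero⟩
    have hsum := mvaeval_cons_eq_sum R (![γ', (p : ℂ), (q : ℂ)]) (Real.pi : ℂ) (K := K) (by rw [hK])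
    have hcons : (Fin.cons (Real.pi : ℂ) (![γ', (p : ℂ), (q : ℂ)]) : Fin 4 → ℂ) =
        ![(Real.pi : ℂ), γ', (p : ℂ), (q : ℂ)] := rfl
    rw [hcons] at hsum
    have hev' : MvPolynomial.aeval ![(Real.pi : ℂ), γ', (p : ℂ), (q : ℂ)] R = 0 := hev
    rw [hsum] at hev'
    have hzero := coeffs_eq_zero_of_sum_pi_pow hγ' p q (fun k => ycoeff R k) hev' K
      (Finset.self_mem_range_succ K)
    have h1 : Polynomial.aeval γ' (specT (ycoeff R K) p q) = 0 := by
      rw [aeval_specT]; simpa using hzero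
    have h2 : minpoly ℚ γ ∣ specT (ycoeff R K) p q := by
      rw [show minpoly ℚ γ = minpoly ℚ γ' from hconj]; exact minpoly.dvd ℚ γ' h1
    have h3 : Polynomial.aeval γ (specT (ycoeff R K) p q) = 0 :=
      Polynomial.aeval_eq_zero_of_dvd_aeval_eq_zero h2 (minpoly.aeval ℚ γ)
    rw [aeval_specT] at h3
    simpa using h3

/-- `A_k / E_k = a_k` and `B_k / E_k = b_k` for `A = num a · den b`, `B = num b · den a`, `E = den a · den b`. -/
private theorem cast_div_eq (a b : ℚ) :
    ((((a.num * b.den : ℤ)) : ℂ)) / (((a.den * b.den : ℕ)) : ℂ) = (a : ℂ) ∧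
      ((((b.num * a.den : ℤ)) : ℂ)) / (((a.den * b.den : ℕ)) : ℂ) = (b : ℂ) := by
  have ha : (a.den : ℂ) ≠ 0 := by exact_mod_cast a.den_ne_zero
  have hb : (b.den : ℂ) ≠ 0 := by exact_mod_cast b.den_ne_zero
  constructor
  · push_cast
    rw [mul_div_mul_right _ _ hb, Rat.cast_def]
  · push_cast
    rw [mul_comm (a.den : ℂ), mul_div_mul_right _ _ ha, Rat.cast_def]

end CaseI

end Bilog
end LatCell
end HyperCell
end Summit.Schanuel.Schanuel.Theorems.RootDecomp1KHyper
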